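import Summits.QuantumFields.YangMills.Theorems.ColdStartUniversalityLatticeLangevinLiebRobinsonFieldWeighted
import Literature.Analysis.ODE.IntegralGronwall
import HarnessLib

/-!
# Route `ColdStartUniversality` (fixed-cut-off SZZ dynamics; LIEB–ROBINSON / LOCALITY package, file 3):
# ★★★ THE PATHWISE LIEB–ROBINSON BOUND — weighted Lipschitz dependence of the SZZ solution on its start, path by path

Helper file (seat `ym-line-csu-p1`, g30; `--supports stmt-QuantumFields-24809`).  For the `SU(2)` lattice Langevin dynamics of
Shen–Zhu–Zhu on `(ℤ/L)³` at ANY coupling `β` and ANY volume, and for every weight `w ≥ 0` on links with `w_e ≤ K·w_f` whenever `f` is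
one of the other links of a plaquette through `e`:
* `exists_frobCLM` — a real continuous linear "Frobenius coordinate" `Φ_e` of the matrix configuration space with `‖Φ_e v‖ = ‖v_e‖_F`
  (blockwise Bochner estimates although the configuration space carries the sup norm);
* ★★ `weighted_gronwall_pathDriven` — weighted `ℓ¹`-Frobenius Grönwall lemma for two solutions of one path-driven equation
  (`Literature.Analysis.ODE.gronwall_integral_le_on`);
* ★★★ `pathwise_liebRobinson` — for regular solution families `U` (coupling `β`) and `B` (free) on one flat noise, all starts
  `b, x, x'`, every horizon `T ≥ 0`: almost surely, for all `τ ∈ [0,1]`,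
  `Σ_e w_e ‖ρU^x_e(Tτ) − ρU^{x'}_e(Tτ)‖_F ≤ exp(T·|β|(4 + 4√2 + 12K)·τ)·Σ_e w_e ‖ρx_e − ρx'_e‖_F`
  (Doss–Sussmann conjugation `dossSussmann_isPathDrivenSolution` + `weighted_dossSussmannField_lipschitz` + Grönwall);
* ★★★ `exists_solutionFamily_liebRobinson` — packaged: a solution family from all starts with this property at every lattice time.
With `w_e = K^{d(e,e₀)}` (`d` = graph distance through plaquettes) a perturbation of the start at the link `e₀` is felt at the link `e` at
lattice time `t` by at most `K^{−d(e,e₀)}·e^{|β|(4+4√2+12K)t}` in Frobenius distance, for EVERY noise path: a finite speed of propagation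
(`≈ |β|(4+4√2+12K)/log K` links per unit lattice time), uniform in the volume — the locality input («Lieb–Robinson / locality for O(1)
every-start mixing of local observables», memo g29 §3) that the duality route to gradient bounds could not give.
THEOREMS ONLY, no definition, no sorry; all [folklore] (Lieb–Robinson-type locality for lattice diffusions; the tree's Doss–Sussmann
programme g23/g24 for the representation).  HONEST FRAMING: fixed cut-off; the propagation speed grows like `|β|`, so in the route's
scaling `β'_K = (γε_K)⁻¹/2 → ∞` this gives NO `K`-uniform locality in physical units; no crux, rung or summit statement is proved; the
Yang–Mills mass gap is NOT proved.
-/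

set_option autoImplicit false

noncomputable section

namespace Summit.QuantumFields.YangMills.Theorems.ColdStartUniversality.LiebRobinson

open MeasureTheory Matrix Finset Set unitInterval
open scoped BigOperators Matrix ComplexConjugate NNReal Topology
open Literature.MathematicalPhysics.QuantumFieldTheory
open Literature.MathematicalPhysics.QuantumLattice (fundamentalRep fundamentalLatticeRep)

/-! ## §1. A Frobenius "coordinate" for each link: a continuous linear map whose norm is `‖v_e‖_F` -/

section FrobCLM

variable {L : ℕ} [NeZero L]

/-- For every link `e` there is a real continuous linear map from matrix configurations to a Euclidean space whose norm is
EXACTLY the Frobenius norm of the `e`-block: `‖Φ_e v‖ = ‖v_e‖_F` (so that Bochner integrals can be estimated blockwise in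
`‖·‖_F` although the configuration space carries the sup norm). [folklore] -/
theorem exists_frobCLM (e : Edge 3 L) :
    ∃ Φ : (Edge 3 L → Fin (fundamentalLatticeRep 2).N → Fin (fundamentalLatticeRep 2).N → ℂ) →L[ℝ]
        EuclideanSpace ℂ (Fin (fundamentalLatticeRep 2).N × Fin (fundamentalLatticeRep 2).N),
      ∀ v, ‖Φ v‖ = frobNorm (Matrix.of (v e)) := by
  let Φₗ : (Edge 3 L → Fin (fundamentalLatticeRep 2).N → Fin (fundamentalLatticeRep 2).N → ℂ) →ₗ[ℝ]
      EuclideanSpace ℂ (Fin (fundamentalLatticeRep 2).N × Fin (fundamentalLatticeRep 2).N) :=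
    { toFun := fun v => WithLp.toLp 2 (fun kl => v e kl.1 kl.2)
      map_add' := fun v w => rfl
      map_smul' := fun c v => rfl }
  refine ⟨LinearMap.toContinuousLinearMap Φₗ, fun v => ?_⟩
  rw [LinearMap.coe_toContinuousLinearMap', EuclideanSpace.norm_eq, frobNorm]
  congr 1
  rw [Fintype.sum_prod_type]
  rfl

end FrobCLM

/-! ## §2. Weighted Grönwall for two solutions of one path-driven equation -/

section Gronwall

variable {L : ℕ} [NeZero L]

/-- ★★ **Weighted `ℓ¹`-Frobenius Grönwall lemma for path-driven equations.**  Let `V, V'` solve the same path-driven equation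
`V(τ) = V(0) + ∫₀^τ T·G(c(s), V(s)) ds` on `[0,1]` (driver `c`, continuous field `G`, horizon `T ≥ 0`), and suppose that ALONG the
two solutions the field is Lipschitz in the weighted seminorm `N(v) = Σ_e w_e ‖v_e‖_F` with constant `Λ`:
`N(G(c(s),V(s)) − G(c(s),V'(s))) ≤ Λ·N(V(s) − V'(s))` for `s ∈ [0,1]`.  Then `N(V(τ) − V'(τ)) ≤ e^{TΛτ} N(V(0) − V'(0))`.
(Blockwise: `Φ_e` commutes with the Bochner integral; integral Grönwall `Literature.Analysis.ODE.gronwall_integral_le_on`.) [folklore] -/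
theorem weighted_gronwall_pathDriven
    {G : (Edge 3 L → Fin (fundamentalLatticeRep 2).N → Fin (fundamentalLatticeRep 2).N → ℂ) ×
        (Edge 3 L → Fin (fundamentalLatticeRep 2).N → Fin (fundamentalLatticeRep 2).N → ℂ) →
        (Edge 3 L → Fin (fundamentalLatticeRep 2).N → Fin (fundamentalLatticeRep 2).N → ℂ)}
    (hGc : Continuous G) {T : ℝ} (hT : 0 ≤ T)
    (c V V' : C(I, Edge 3 L → Fin (fundamentalLatticeRep 2).N → Fin (fundamentalLatticeRep 2).N → ℂ))
    (hV : ∀ τ : I, V τ = V 0 + ∫ s in (0:ℝ)..(τ:ℝ), T • G (IccExtend zero_le_one c s, IccExtend zero_le_one V s))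
    (hV' : ∀ τ : I, V' τ = V' 0 + ∫ s in (0:ℝ)..(τ:ℝ), T • G (IccExtend zero_le_one c s, IccExtend zero_le_one V' s))
    (w : Edge 3 L → ℝ) (hw0 : ∀ e, 0 ≤ w e) {Λ : ℝ} (hΛ : 0 ≤ Λ)
    (hLip : ∀ s : I, ∑ e, w e * frobNorm (Matrix.of ((G (c s, V s) - G (c s, V' s)) e)) ≤
      Λ * ∑ e, w e * frobNorm (Matrix.of ((V s - V' s) e))) :
    ∀ τ : I, ∑ e, w e * frobNorm (Matrix.of ((V τ - V' τ) e)) ≤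
      Real.exp (T * Λ * τ) * ∑ e, w e * frobNorm (Matrix.of ((V 0 - V' 0) e)) := by
  classical
  choose Φ hΦ using fun e : Edge 3 L => exists_frobCLM (L := L) e
  -- the extended paths and the integrands
  set Vt := IccExtend zero_le_one V with hVt
  set Vt' := IccExtend zero_le_one V' with hVt'
  set ct := IccExtend zero_le_one c with hct
  have cVt : Continuous Vt := V.continuous.Icc_extend'
  have cVt' : Continuous Vt' := V'.continuous.Icc_extend'
  have cct : Continuous ct := c.continuous.Icc_extend'
  set g : ℝ → (Edge 3 L → Fin (fundamentalLatticeRep 2).N → Fin (fundamentalLatticeRep 2).N → ℂ) :=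
    fun s => T • G (ct s, Vt s) with hg
  set g' : ℝ → (Edge 3 L → Fin (fundamentalLatticeRep 2).N → Fin (fundamentalLatticeRep 2).N → ℂ) :=
    fun s => T • G (ct s, Vt' s) with hg'
  have cg : Continuous g := (hGc.comp (cct.prodMk cVt)).const_smul T
  have cg' : Continuous g' := (hGc.comp (cct.prodMk cVt')).const_smul T
  -- the weighted distance as a continuous function on `ℝ`
  set Nf : ℝ → ℝ := fun s => ∑ e, w e * ‖Φ e (Vt s - Vt' s)‖ with hNf
  have cNf : Continuous Nf :=
    continuous_finsetSum _ fun e _ => continuous_const.mul ((Φ e).continuous.comp (cVt.sub cVt')).norm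
  have hNf_eq : ∀ s : I, Nf s = ∑ e, w e * frobNorm (Matrix.of ((V s - V' s) e)) := by
    intro s
    simp only [hNf, hVt, hVt', Set.IccExtend_val, hΦ]
  -- the integral inequality
  have hineq : ∀ t ∈ Set.Icc (0:ℝ) 1, Nf t ≤ Nf 0 + ∫ s in (0:ℝ)..t, (T * Λ) * Nf s := by
    intro t ht
    have ht' : (⟨t, ht⟩ : I) = ⟨t, ht⟩ := rfl
    have hVt_t : Vt t = V ⟨t, ht⟩ := Set.IccExtend_of_mem _ _ ht
    have hVt'_t : Vt' t = V' ⟨t, ht⟩ := Set.IccExtend_of_mem _ _ ht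
    have hVt_0 : Vt 0 = V 0 := Set.IccExtend_of_mem _ _ ⟨le_rfl, zero_le_one⟩
    have hVt'_0 : Vt' 0 = V' 0 := Set.IccExtend_of_mem _ _ ⟨le_rfl, zero_le_one⟩
    have ig : IntervalIntegrable g MeasureTheory.volume 0 t := cg.intervalIntegrable _ _
    have ig' : IntervalIntegrable g' MeasureTheory.volume 0 t := cg'.intervalIntegrable _ _
    -- difference of the two integral equations
    have hdiff : Vt t - Vt' t = (Vt 0 - Vt' 0) + ∫ s in (0:ℝ)..t, (g s - g' s) := by
      rw [intervalIntegral.integral_sub ig ig', hVt_t, hVt'_t, hVt_0, hVt'_0, hV ⟨t, ht⟩, hV' ⟨t, ht⟩]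
      simp only [hg, hg', hct, hVt, hVt']
      abel
    -- blockwise Frobenius estimate
    have hblock : ∀ e, ‖Φ e (Vt t - Vt' t)‖ ≤ ‖Φ e (Vt 0 - Vt' 0)‖ + ∫ s in (0:ℝ)..t, ‖Φ e (g s - g' s)‖ := by
      intro e
      have igg : IntervalIntegrable (fun s => g s - g' s) MeasureTheory.volume 0 t := ig.sub ig'
      rw [hdiff, map_add, ← (Φ e).intervalIntegral_comp_comm igg]
      exact (norm_add_le _ _).trans (add_le_add le_rfl (intervalIntegral.norm_integral_le_integral_norm ht.1))
    -- the integrand is controlled by the weighted Lipschitz hypothesis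
    have hpt : ∀ s ∈ Set.Icc (0:ℝ) t, ∑ e, w e * ‖Φ e (g s - g' s)‖ ≤ (T * Λ) * Nf s := by
      intro s hs
      have hs1 : s ∈ Set.Icc (0:ℝ) 1 := ⟨hs.1, hs.2.trans ht.2⟩
      have hcs : ct s = c ⟨s, hs1⟩ := Set.IccExtend_of_mem _ _ hs1
      have hVs : Vt s = V ⟨s, hs1⟩ := Set.IccExtend_of_mem _ _ hs1
      have hVs' : Vt' s = V' ⟨s, hs1⟩ := Set.IccExtend_of_mem _ _ hs1
      have hgs : g s - g' s = T • (G (c ⟨s, hs1⟩, V ⟨s, hs1⟩) - G (c ⟨s, hs1⟩, V' ⟨s, hs1⟩)) := by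
        simp only [hg, hg', hcs, hVs, hVs', smul_sub]
      have hL := hLip ⟨s, hs1⟩
      have hN : Nf s = ∑ e, w e * frobNorm (Matrix.of ((V ⟨s, hs1⟩ - V' ⟨s, hs1⟩) e)) := hNf_eq ⟨s, hs1⟩
      rw [hN]
      calc ∑ e, w e * ‖Φ e (g s - g' s)‖
          = T * ∑ e, w e * frobNorm (Matrix.of ((G (c ⟨s, hs1⟩, V ⟨s, hs1⟩) - G (c ⟨s, hs1⟩, V' ⟨s, hs1⟩)) e)) := by
            rw [Finset.mul_sum]
            refine Finset.sum_congr rfl fun e _ => ?_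
            rw [hgs, map_smul, norm_smul, Real.norm_eq_abs, abs_of_nonneg hT, hΦ]
            ring
        _ ≤ T * (Λ * ∑ e, w e * frobNorm (Matrix.of ((V ⟨s, hs1⟩ - V' ⟨s, hs1⟩) e))) :=
            mul_le_mul_of_nonneg_left hL hT
        _ = (T * Λ) * ∑ e, w e * frobNorm (Matrix.of ((V ⟨s, hs1⟩ - V' ⟨s, hs1⟩) e)) := by ring
    -- sum the blockwise estimates
    have hsum : Nf t ≤ Nf 0 + ∫ s in (0:ℝ)..t, ∑ e, w e * ‖Φ e (g s - g' s)‖ := by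
      have hint : ∀ e, IntervalIntegrable (fun s => w e * ‖Φ e (g s - g' s)‖) MeasureTheory.volume 0 t := fun e =>
        (continuous_const.mul ((Φ e).continuous.comp (cg.sub cg')).norm).intervalIntegrable _ _
      rw [intervalIntegral.integral_finsetSum (fun e _ => hint e)]
      simp only [hNf, ← Finset.sum_add_distrib]
      refine Finset.sum_le_sum fun e _ => ?_
      rw [intervalIntegral.integral_const_mul, ← mul_add]
      exact mul_le_mul_of_nonneg_left (hblock e) (hw0 e)
    refine hsum.trans (add_le_add le_rfl ?_)
    refine intervalIntegral.integral_mono_on ht.1 ?_ ?_ hpt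
    · exact (continuous_finsetSum _ fun e _ =>
        continuous_const.mul ((Φ e).continuous.comp (cg.sub cg')).norm).intervalIntegrable _ _
    · exact (continuous_const.mul cNf).intervalIntegrable _ _
  -- Grönwall
  have hG := Literature.Analysis.ODE.gronwall_integral_le_on (a := fun _ => T * Λ) (g := Nf) (h := fun _ => Nf 0) (T := 1)
    continuous_const cNf (fun _ => mul_nonneg hT hΛ) (fun _ _ _ _ _ => le_rfl) hineq
  intro τ
  have hτ : (τ : ℝ) ∈ Set.Icc (0:ℝ) 1 := τ.2
  have h := hG τ hτ
  rw [intervalIntegral.integral_const, smul_eq_mul, sub_zero, hNf_eq τ] at h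
  have h0 : Nf 0 = ∑ e, w e * frobNorm (Matrix.of ((V 0 - V' 0) e)) := hNf_eq 0
  rw [h0] at h
  calc ∑ e, w e * frobNorm (Matrix.of ((V τ - V' τ) e))
      ≤ (∑ e, w e * frobNorm (Matrix.of ((V 0 - V' 0) e))) * Real.exp ((τ : ℝ) * (T * Λ)) := h
    _ = Real.exp (T * Λ * τ) * ∑ e, w e * frobNorm (Matrix.of ((V 0 - V' 0) e)) := by rw [mul_comm ((τ : ℝ))]; ring

end Gronwall

/-! ## §3. The pathwise Lieb–Robinson bound for the SU(2) SZZ dynamics -/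

section Pathwise

variable {L : ℕ} [NeZero L]

/-- ★★★ **PATHWISE LIEB–ROBINSON BOUND (weighted Lipschitz dependence on the start, path by path).**  For the `SU(2)` lattice
Langevin dynamics of Shen–Zhu–Zhu on `(ℤ/L)³` at ANY coupling `β`, realised by regular solution families `U` (coupling `β`) and `B`
(free, `β = 0`) on one flat noise, every weight `w ≥ 0` on links with `w_e ≤ K·w_f` across plaquettes (`K ≥ 0`), all starts `b, x, x'`
and every horizon `T ≥ 0`: almost surely, for all `τ ∈ [0,1]`,
`Σ_e w_e ‖ρU^x_e(Tτ) − ρU^{x'}_e(Tτ)‖_F ≤ exp(T·|β|(4 + 4√2 + 12K)·τ) · Σ_e w_e ‖ρx_e − ρx'_e‖_F`.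
With `w_e = K^{d(e,e₀)}` (graph distance through plaquettes): a perturbation of the start at `e₀` is felt at `e` at time `t` by at most
`K^{−d(e,e₀)} e^{|β|(4+4√2+12K)t}` — a finite speed of propagation `|β|(4+4√2+12K)/log K` links per unit lattice time, uniformly in
the volume and in the noise path.  Proof: Doss–Sussmann conjugation by the free Brownian motion (`dossSussmann_isPathDrivenSolution`),
the link-local Lipschitz estimate `weighted_dossSussmannField_lipschitz`, and the weighted Grönwall lemma. [folklore] -/
theorem pathwise_liebRobinson (β : ℝ) {Ω : Type} [MeasurableSpace Ω] {P : Measure Ω} [IsProbabilityMeasure P]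
    {W : ℝ≥0 → Ω → (Edge 3 L × NoiseIdx 2 → ℝ)} (hW : IsFlatBrownian W P)
    (B U : GaugeConfig 3 L (Matrix.specialUnitaryGroup (Fin 2) ℂ) → ℝ≥0 → Ω →
      GaugeConfig 3 L (Matrix.specialUnitaryGroup (Fin 2) ℂ))
    (hB : ∀ x, (∀ ω, B x 0 ω = x) ∧
      (latticeLangevinDynamics (fundamentalLatticeRep 2) 0).IsSolution (fundamentalRep (Fin 2)) hW.natFiltration P W (B x))
    (hBm : ∀ i : ℝ≥0, Measurable[@Prod.instMeasurableSpace (Set.Iic i)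
        (GaugeConfig 3 L (Matrix.specialUnitaryGroup (Fin 2) ℂ) × Ω) inferInstance
        (@Prod.instMeasurableSpace (GaugeConfig 3 L (Matrix.specialUnitaryGroup (Fin 2) ℂ)) Ω inferInstance
          (hW.natFiltration i))]
      (fun q : Set.Iic i × (GaugeConfig 3 L (Matrix.specialUnitaryGroup (Fin 2) ℂ) × Ω) => B q.2.1 q.1 q.2.2))
    (hU : ∀ x, (∀ ω, U x 0 ω = x) ∧
      (latticeLangevinDynamics (fundamentalLatticeRep 2) β).IsSolution (fundamentalRep (Fin 2)) hW.natFiltration P W (U x))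
    (hUm : ∀ i : ℝ≥0, Measurable[@Prod.instMeasurableSpace (Set.Iic i)
        (GaugeConfig 3 L (Matrix.specialUnitaryGroup (Fin 2) ℂ) × Ω) inferInstance
        (@Prod.instMeasurableSpace (GaugeConfig 3 L (Matrix.specialUnitaryGroup (Fin 2) ℂ)) Ω inferInstance
          (hW.natFiltration i))]
      (fun q : Set.Iic i × (GaugeConfig 3 L (Matrix.specialUnitaryGroup (Fin 2) ℂ) × Ω) => U q.2.1 q.1 q.2.2))
    (w : Edge 3 L → ℝ) (hw0 : ∀ e, 0 ≤ w e) (K : ℝ) (hK : 0 ≤ K)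
    (hw : ∀ (e : Edge 3 L) (j : Fin 3), j ≠ e.2 →
      w e ≤ K * w (e.1.shift e.2, j) ∧ w e ≤ K * w (e.1.shift j, e.2) ∧ w e ≤ K * w (e.1, j) ∧
      w e ≤ K * w ((e.1 - Pi.single j 1).shift e.2, j) ∧ w e ≤ K * w (e.1 - Pi.single j 1, e.2) ∧
      w e ≤ K * w (e.1 - Pi.single j 1, j))
    (b x x' : GaugeConfig 3 L (Matrix.specialUnitaryGroup (Fin 2) ℂ)) {T : ℝ} (hT : 0 ≤ T) :
    ∀ᵐ ω ∂P, ∀ τ : I,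
      ∑ e, w e * frobNorm ((fundamentalLatticeRep 2).ρ (U x (T * (τ : ℝ)).toNNReal ω e) -
          (fundamentalLatticeRep 2).ρ (U x' (T * (τ : ℝ)).toNNReal ω e)) ≤
        Real.exp (T * (|β| * (4 + 4 * Real.sqrt 2 + 12 * K)) * τ) *
          ∑ e, w e * frobNorm ((fundamentalLatticeRep 2).ρ (x e) - (fundamentalLatticeRep 2).ρ (x' e)) := by
  classical
  obtain ⟨G, hGs, hGF, -⟩ := exists_tamed_dossSussmannField (L := L) β
  have hGc : Continuous G := hGs.continuous
  have hρu : ∀ g : Matrix.specialUnitaryGroup (Fin 2) ℂ,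
      (fundamentalLatticeRep 2).ρ g ∈ Matrix.unitaryGroup (Fin (fundamentalLatticeRep 2).N) ℂ :=
    (fundamentalLatticeRep 2).mem_unitary
  have h1 := dossSussmann_isPathDrivenSolution β hGc hGF hW B U hB hBm hU hUm b x hT
  have h2 := dossSussmann_isPathDrivenSolution β hGc hGF hW B U hB hBm hU hUm b x' hT
  filter_upwards [h1, h2] with ω h1ω h2ω
  obtain ⟨hc, hV, hVeq⟩ := h1ω
  obtain ⟨hc', hV', hV'eq⟩ := h2ω
  set c : C(I, Edge 3 L → Fin (fundamentalLatticeRep 2).N → Fin (fundamentalLatticeRep 2).N → ℂ) := ⟨_, hc⟩ with hcdef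
  set V : C(I, Edge 3 L → Fin (fundamentalLatticeRep 2).N → Fin (fundamentalLatticeRep 2).N → ℂ) := ⟨_, hV⟩ with hVdef
  set V' : C(I, Edge 3 L → Fin (fundamentalLatticeRep 2).N → Fin (fundamentalLatticeRep 2).N → ℂ) := ⟨_, hV'⟩ with hV'def
  -- initial values
  have hT0 : (T * ((0 : I) : ℝ)).toNNReal = 0 := by simp
  have hV0 : V 0 = fun (e : Edge 3 L) (k l : Fin (fundamentalLatticeRep 2).N) =>
      ((((fundamentalLatticeRep 2).ρ (b e))ᴴ * (fundamentalLatticeRep 2).ρ (x e)) k l) := by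
    funext e k l
    show ((((fundamentalLatticeRep 2).ρ (B b (T * ((0 : I) : ℝ)).toNNReal ω e))ᴴ *
      (fundamentalLatticeRep 2).ρ (U x (T * ((0 : I) : ℝ)).toNNReal ω e)) k l) = _
    rw [hT0, (hB b).1 ω, (hU x).1 ω]
  have hV'0 : V' 0 = fun (e : Edge 3 L) (k l : Fin (fundamentalLatticeRep 2).N) =>
      ((((fundamentalLatticeRep 2).ρ (b e))ᴴ * (fundamentalLatticeRep 2).ρ (x' e)) k l) := by
    funext e k l
    show ((((fundamentalLatticeRep 2).ρ (B b (T * ((0 : I) : ℝ)).toNNReal ω e))ᴴ *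
      (fundamentalLatticeRep 2).ρ (U x' (T * ((0 : I) : ℝ)).toNNReal ω e)) k l) = _
    rw [hT0, (hB b).1 ω, (hU x').1 ω]
  have hVeq' : ∀ τ : I, V τ = V 0 + ∫ s in (0:ℝ)..(τ:ℝ), T • G (IccExtend zero_le_one c s, IccExtend zero_le_one V s) := by
    intro τ; rw [hV0]; exact hVeq τ
  have hV'eq' : ∀ τ : I, V' τ = V' 0 + ∫ s in (0:ℝ)..(τ:ℝ), T • G (IccExtend zero_le_one c s, IccExtend zero_le_one V' s) := by
    intro τ; rw [hV'0]; exact hV'eq τ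
  -- the weighted Lipschitz estimate along the two paths
  have hLip : ∀ s : I, ∑ e, w e * frobNorm (Matrix.of ((G (c s, V s) - G (c s, V' s)) e)) ≤
      (|β| * (4 + 4 * Real.sqrt 2 + 12 * K)) * ∑ e, w e * frobNorm (Matrix.of ((V s - V' s) e)) := by
    intro s
    have hn : ‖(V s : Edge 3 L → Fin (fundamentalLatticeRep 2).N → Fin (fundamentalLatticeRep 2).N → ℂ)‖ ≤ 1 :=
      norm_conjProduct_config_le_one (B b (T * (s : ℝ)).toNNReal ω) (U x (T * (s : ℝ)).toNNReal ω)
    have hn' : ‖(V' s : Edge 3 L → Fin (fundamentalLatticeRep 2).N → Fin (fundamentalLatticeRep 2).N → ℂ)‖ ≤ 1 :=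
      norm_conjProduct_config_le_one (B b (T * (s : ℝ)).toNNReal ω) (U x' (T * (s : ℝ)).toNNReal ω)
    set p : Edge 3 L → Matrix (Fin (fundamentalLatticeRep 2).N) (Fin (fundamentalLatticeRep 2).N) ℂ :=
      fun f => Matrix.of (c s f) with hp
    set M : Edge 3 L → Matrix (Fin (fundamentalLatticeRep 2).N) (Fin (fundamentalLatticeRep 2).N) ℂ :=
      fun f => Matrix.of (V s f) with hM
    set M' : Edge 3 L → Matrix (Fin (fundamentalLatticeRep 2).N) (Fin (fundamentalLatticeRep 2).N) ℂ :=
      fun f => Matrix.of (V' s f) with hM'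
    have hpu : ∀ f, p f ∈ Matrix.unitaryGroup (Fin (fundamentalLatticeRep 2).N) ℂ := fun f => hρu _
    have hMu : ∀ f, M f ∈ Matrix.unitaryGroup (Fin (fundamentalLatticeRep 2).N) ℂ := fun f => by
      show ((fundamentalLatticeRep 2).ρ (B b (T * (s : ℝ)).toNNReal ω f))ᴴ * (fundamentalLatticeRep 2).ρ (U x (T * (s : ℝ)).toNNReal ω f)
        ∈ Matrix.unitaryGroup (Fin (fundamentalLatticeRep 2).N) ℂ
      exact Submonoid.mul_mem _ (conjTranspose_mem_unitaryGroup (hρu _)) (hρu _)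
    have hM'u : ∀ f, M' f ∈ Matrix.unitaryGroup (Fin (fundamentalLatticeRep 2).N) ℂ := fun f => by
      show ((fundamentalLatticeRep 2).ρ (B b (T * (s : ℝ)).toNNReal ω f))ᴴ * (fundamentalLatticeRep 2).ρ (U x' (T * (s : ℝ)).toNNReal ω f)
        ∈ Matrix.unitaryGroup (Fin (fundamentalLatticeRep 2).N) ℂ
      exact Submonoid.mul_mem _ (conjTranspose_mem_unitaryGroup (hρu _)) (hρu _)
    have hF := weighted_dossSussmannField_lipschitz (L := L) β p M M' hpu hMu hM'u w hw0 K hw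
    have hGe : ∀ e, Matrix.of ((G (c s, V s) - G (c s, V' s)) e) =
        (p e)ᴴ * (fundamentalLatticeRep 2).driftLie β (fun f => p f * M f) e * (p e * M e) -
          (p e)ᴴ * (fundamentalLatticeRep 2).driftLie β (fun f => p f * M' f) e * (p e * M' e) := by
      intro e
      rw [Pi.sub_apply, hGF _ _ hn, hGF _ _ hn']
      rfl
    have hVe : ∀ e, Matrix.of ((V s - V' s) e) = M e - M' e := fun e => rfl
    simp only [hGe, hVe]
    exact hF
  -- Grönwall
  have hG := weighted_gronwall_pathDriven (L := L) hGc hT c V V' hVeq' hV'eq' w hw0 (by positivity) hLip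
  intro τ
  have h := hG τ
  -- translate back to the solutions
  have hlhs : ∀ e, frobNorm (Matrix.of ((V τ - V' τ) e)) =
      frobNorm ((fundamentalLatticeRep 2).ρ (U x (T * (τ : ℝ)).toNNReal ω e) -
        (fundamentalLatticeRep 2).ρ (U x' (T * (τ : ℝ)).toNNReal ω e)) := by
    intro e
    have : Matrix.of ((V τ - V' τ) e) = ((fundamentalLatticeRep 2).ρ (B b (T * (τ : ℝ)).toNNReal ω e))ᴴ *
        ((fundamentalLatticeRep 2).ρ (U x (T * (τ : ℝ)).toNNReal ω e) - (fundamentalLatticeRep 2).ρ (U x' (T * (τ : ℝ)).toNNReal ω e)) := by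
      rw [Matrix.mul_sub]; rfl
    rw [this, frobNorm_unitary_mul (conjTranspose_mem_unitaryGroup (hρu _))]
  have hrhs : ∀ e, frobNorm (Matrix.of ((V 0 - V' 0) e)) =
      frobNorm ((fundamentalLatticeRep 2).ρ (x e) - (fundamentalLatticeRep 2).ρ (x' e)) := by
    intro e
    have : Matrix.of ((V 0 - V' 0) e) = ((fundamentalLatticeRep 2).ρ (b e))ᴴ *
        ((fundamentalLatticeRep 2).ρ (x e) - (fundamentalLatticeRep 2).ρ (x' e)) := by
      rw [hV0, hV'0, Matrix.mul_sub]; rfl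
    rw [this, frobNorm_unitary_mul (conjTranspose_mem_unitaryGroup (hρu _))]
  simp only [hlhs, hrhs] at h
  calc _ ≤ _ := h
    _ = _ := by ring_nf

end Pathwise

/-! ## §4. Packaged form: a solution family with the Lieb–Robinson property at every time -/

section Packaged

variable {L : ℕ} [NeZero L]

/-- ★★★ **Lieb–Robinson bound for the SZZ solution flow (packaged).**  On every probability space carrying a flat Brownian driver
there is a family `U` of strong solutions of the `SU(2)` SZZ Langevin SDE at coupling `β` from all deterministic starts (the regular flow
of `exists_regularFlow`) such that for every weight `w ≥ 0` with `w_e ≤ K·w_f` across plaquettes, all starts `x, x'` and every lattice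
time `t`: almost surely `Σ_e w_e ‖ρU^x_e(t) − ρU^{x'}_e(t)‖_F ≤ e^{|β|(4+4√2+12K)t} Σ_e w_e ‖ρx_e − ρx'_e‖_F`. [folklore] -/
theorem exists_solutionFamily_liebRobinson (β : ℝ) {Ω : Type} [MeasurableSpace Ω] {P : Measure Ω} [IsProbabilityMeasure P]
    {W : ℝ≥0 → Ω → (Edge 3 L × NoiseIdx 2 → ℝ)} (hW : IsFlatBrownian W P) :
    ∃ U : GaugeConfig 3 L (Matrix.specialUnitaryGroup (Fin 2) ℂ) → ℝ≥0 → Ω →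
        GaugeConfig 3 L (Matrix.specialUnitaryGroup (Fin 2) ℂ),
      (∀ x, (∀ ω, U x 0 ω = x) ∧
        (latticeLangevinDynamics (fundamentalLatticeRep 2) β).IsSolution (fundamentalRep (Fin 2)) hW.natFiltration P W (U x)) ∧
      ∀ (w : Edge 3 L → ℝ), (∀ e, 0 ≤ w e) → ∀ (K : ℝ), 0 ≤ K →
        (∀ (e : Edge 3 L) (j : Fin 3), j ≠ e.2 →
          w e ≤ K * w (e.1.shift e.2, j) ∧ w e ≤ K * w (e.1.shift j, e.2) ∧ w e ≤ K * w (e.1, j) ∧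
          w e ≤ K * w ((e.1 - Pi.single j 1).shift e.2, j) ∧ w e ≤ K * w (e.1 - Pi.single j 1, e.2) ∧
          w e ≤ K * w (e.1 - Pi.single j 1, j)) →
        ∀ (x x' : GaugeConfig 3 L (Matrix.specialUnitaryGroup (Fin 2) ℂ)) (t : ℝ≥0), ∀ᵐ ω ∂P,
          ∑ e, w e * frobNorm ((fundamentalLatticeRep 2).ρ (U x t ω e) - (fundamentalLatticeRep 2).ρ (U x' t ω e)) ≤
            Real.exp (|β| * (4 + 4 * Real.sqrt 2 + 12 * K) * (t : ℝ)) *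
              ∑ e, w e * frobNorm ((fundamentalLatticeRep 2).ρ (x e) - (fundamentalLatticeRep 2).ρ (x' e)) := by
  obtain ⟨U, -, hU, hUm, -⟩ := exists_regularFlow L β hW
  obtain ⟨B, -, hB, hBm, -⟩ := exists_regularFlow L 0 hW
  refine ⟨U, hU, fun w hw0 K hK hw x x' t => ?_⟩
  have h := pathwise_liebRobinson β hW B U hB hBm hU hUm w hw0 K hK hw x x x' (T := (t : ℝ)) t.2
  filter_upwards [h] with ω hω
  have h1 := hω 1
  have ht : ((t : ℝ) * ((1 : I) : ℝ)).toNNReal = t := by simp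
  rw [ht] at h1
  refine h1.trans (le_of_eq ?_)
  congr 1
  congr 1
  simp only [Set.Icc.coe_one, mul_one]
  ring

end Packaged

end Summit.QuantumFields.YangMills.Theorems.ColdStartUniversality.LiebRobinson
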